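import Summits.ResolutionOfSingularities.ResolutionOfSingularities.Theorems.PAlterationAssemblyLevelModel
import Summits.ResolutionOfSingularities.ResolutionOfSingularities.Theorems.PAlterationPialtKnownCases
import Literature.AlgebraicGeometry.Resolution.AlterationsPurelyInseparable
import Mathlib.AlgebraicGeometry.Morphisms.FlatDescent
import Mathlib.AlgebraicGeometry.ZariskisMainTheorem
import HarnessLib

/-!
# Crux `PalterationThesis` (stmt-ResolutionOfSingularities-0552), line `Sketch`: PIAlt descends from the perfect closure

Route `ResolutionOfSingularities/pAlteration`; helper file (`--supports stmt-0552`) closing the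
registered stub `stub_pialtOfPerfect` of the line's skeleton. For `X` integral separated of finite
type over `k` (`char k = p`, `K = k^{p^{-∞}}`), a purely inseparable regular alteration of
`X^∞ = (Spec K ×_k X)_red` DESCENDS to one of `X`: embed `R ↪ Spec K ×_k Q`
(`exists_closedImmersion_baseChange`, in tree), descend the closed subscheme to a finitely
generated stage `k(t) ⊆ K` (`exists_stage_model_of_closedImmersion`; Görtz–Wedhorn I, 10.75 —
the in-tree full-level version is not finite over `k` when `[k : k^p] = ∞`), descend regularity
(Matsumura 23.7 (i)), integrality, universal closedness and — over the good open — universal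
injectivity along the faithfully flat `Spec K → Spec k(t)` (fpqc descent), recover finiteness from
properness by Zariski's Main Theorem, and compose with the finite radicial surjective `X_t → X`.
Consequences (`Pialt` ⇔ `Pialt` over perfect fields; the crux-level transfer) are in
`PAlterationPalterationThesisPerfectTransfer.lean`. Sources: Görtz–Wedhorn I, Prop. 10.75, §14;
Matsumura, Thm. 23.7; Stacks 02KW, 02LS, 01S4; Temkin, J. Algebra 373 (2013), §1.3.
-/


-- single-problem summit: the doubled namespace component `ResolutionOfSingularities` is forced
set_option linter.dupNamespace false

noncomputable section

open CategoryTheory CategoryTheory.Limits AlgebraicGeometry TopologicalSpace Topology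

open Opposite Literature.AlgebraicGeometry.Limits Literature.AlgebraicGeometry.Resolution
open Scheme.IdealSheafData

namespace Summit.ResolutionOfSingularities.ResolutionOfSingularities.Theorems

-- as in Mathlib's pullback API for schemes
set_option backward.isDefEq.respectTransparency false in
/-- **Descent of a closed subscheme of `Spec K ×_k Q` to a finitely generated subextension**
`k(t)`, `t ⊆ K` finite, for `K/k` algebraic: `R = Spec K ×_{Spec k(t)} R_t` with `R_t ↪ Spec k(t) ×_k Q`
closed (cartesian square `(m ≫ pr₁, e ; Spec K → Spec k(t), ι_t ≫ pr₁)`, `e ≫ ι_t ≫ pr₂ = m ≫ pr₂`).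
[cite: GortzWedhorn2020, Prop. 10.75 (1), p. 333] -/
theorem exists_stage_model_of_closedImmersion {k K : Type} [Field k] [Field K] [Algebra k K]
    [Algebra.IsAlgebraic k K] (Q : Over (Spec (CommRingCat.of k))) [QuasiCompact Q.hom]
    [IsSeparated Q.hom] [LocallyOfFiniteType Q.hom] {R : Scheme.{0}}
    (m : R ⟶ pullback (Spec.map (CommRingCat.ofHom (algebraMap k K))) Q.hom)
    [IsClosedImmersion m] :
    ∃ (t : Finset K) (Rt : Scheme.{0})
      (ιt : Rt ⟶ pullback (Spec.map (CommRingCat.ofHom (algebraMap k (FieldExt.fld k K t)))) Q.hom)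
      (e : R ⟶ Rt),
      IsClosedImmersion ιt ∧
      IsPullback (m ≫ pullback.fst _ _) e
        (Spec.map (CommRingCat.ofHom (FieldExt.fld k K t).val.toRingHom)) (ιt ≫ pullback.fst _ _) ∧
      e ≫ ιt ≫ pullback.snd _ _ = m ≫ pullback.snd _ _ := by
  -- the diagram `t ↦ Spec k(t) ×_k Q` and its limit cone `Spec K ×_k Q`
  let s₁ : Finset K := ∅
  let D := FieldExt.schemeDiagram k K s₁ (.of k) (FieldExt.baseNat k K s₁) Q
  let c := FieldExt.schemeCone k K s₁ (.of k) (FieldExt.baseNat k K s₁)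
    (CommRingCat.ofHom (algebraMap k K)) (FieldExt.baseNat_ι k K s₁) Q
  let hc := FieldExt.isLimitSchemeCone k K s₁ (.of k) (FieldExt.baseNat k K s₁)
    (CommRingCat.ofHom (algebraMap k K)) (FieldExt.baseNat_ι k K s₁) Q
  have hcpt : c.pt = pullback (Spec.map (CommRingCat.ofHom (algebraMap k K))) Q.hom := rfl
  let m' : R ⟶ c.pt := m
  haveI : IsClosedImmersion m' := ‹IsClosedImmersion m›
  haveI : IsLocallyNoetherian c.pt := by
    rw [hcpt]
    exact LocallyOfFiniteType.isLocallyNoetherian (pullback.fst _ _)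
  -- descent of the closed subscheme to a stage `t`
  obtain ⟨i, hi⟩ := exists_isPullback_toImage_of_isLocallyNoetherian D c hc m'
  let t : Finset K := i.unop.1
  let kt := FieldExt.fld k K t
  let leg : pullback (Spec.map (CommRingCat.ofHom (algebraMap k K))) Q.hom ⟶
      pullback (Spec.map (CommRingCat.ofHom (algebraMap k kt))) Q.hom := c.π.app i
  let Rt := (m ≫ leg).image
  let ιt : Rt ⟶ pullback (Spec.map (CommRingCat.ofHom (algebraMap k kt))) Q.hom := (m ≫ leg).imageι
  let τ : R ⟶ Rt := (m ≫ leg).toImage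
  have H : IsPullback m τ leg ιt := hi i (𝟙 i)
  have Hπ : IsPullback leg (pullback.fst (Spec.map (CommRingCat.ofHom (algebraMap k K))) Q.hom)
      (pullback.fst (Spec.map (CommRingCat.ofHom (algebraMap k kt))) Q.hom)
      (Spec.map (CommRingCat.ofHom kt.val.toRingHom)) :=
    FieldExt.isPullback_π k K s₁ (.of k) (FieldExt.baseNat k K s₁)
      (CommRingCat.ofHom (algebraMap k K)) (FieldExt.baseNat_ι k K s₁) Q i
  have hlegsnd : leg ≫ pullback.snd _ _ =
      pullback.snd (Spec.map (CommRingCat.ofHom (algebraMap k K))) Q.hom :=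
    FieldExt.schemeCone_π_app_snd k K s₁ (.of k) (FieldExt.baseNat k K s₁)
      (CommRingCat.ofHom (algebraMap k K)) (FieldExt.baseNat_ι k K s₁) Q i
  -- `R = Rt ×_{Spec k(t)} Spec K`
  have SqR : IsPullback τ (m ≫ pullback.fst _ _) (ιt ≫ pullback.fst _ _)
      (Spec.map (CommRingCat.ofHom kt.val.toRingHom)) := H.flip.paste_vert Hπ
  refine ⟨t, Rt, ιt, τ, inferInstance, SqR.flip, ?_⟩
  change ((m ≫ leg).toImage ≫ (m ≫ leg).imageι) ≫ pullback.snd _ _ = _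
  rw [Scheme.Hom.toImage_imageι, Category.assoc, hlegsnd]

section Stage

variable (p : ℕ) [Fact p.Prime] (k : Type) [Field k] [CharP k p]

/-- Every element of a stage `k(t) ⊆ k^{p^{-∞}}` has a `p^n`-th power in `k` (the stage fields of
the perfect closure are purely inseparable over `k`). [folklore] -/
theorem stage_pow_mem (t : Finset (PerfectClosure k p)) :
    letI : Algebra k (PerfectClosure k p) := (PerfectClosure.of k p).toAlgebra
    ∀ x : FieldExt.fld k (PerfectClosure k p) t, ∃ (n : ℕ) (y : k),
      algebraMap k (FieldExt.fld k (PerfectClosure k p) t) y = x ^ p ^ n := by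
  letI : Algebra k (PerfectClosure k p) := (PerfectClosure.of k p).toAlgebra
  intro x
  obtain ⟨n, y, hy⟩ := perfectClosure_pow_mem p (x : PerfectClosure k p)
  refine ⟨n, y, Subtype.ext ?_⟩
  change PerfectClosure.of k p y =
    ((x ^ p ^ n : FieldExt.fld k (PerfectClosure k p) t) : PerfectClosure k p)
  rw [hy]
  simp

/-- The perfect closure is algebraic over `k`. [folklore] -/
theorem isAlgebraic_perfectClosure :
    letI : Algebra k (PerfectClosure k p) := (PerfectClosure.of k p).toAlgebra
    Algebra.IsAlgebraic k (PerfectClosure k p) := by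
  letI : Algebra k (PerfectClosure k p) := (PerfectClosure.of k p).toAlgebra
  haveI : IsPRadical (algebraMap k (PerfectClosure k p)) p := PerfectClosure.isPRadical k p
  haveI : IsPurelyInseparable k (PerfectClosure k p) :=
    IsPRadical.isPurelyInseparable k (PerfectClosure k p) p
  exact IsPurelyInseparable.isAlgebraic k (PerfectClosure k p)

/-- `Spec k(t) → Spec k` is finite for a stage `k(t)` of the perfect closure (`k(t)` is a finite
`k`-algebra, being generated by finitely many algebraic elements). [folklore] -/
theorem isFinite_specMap_stage (t : Finset (PerfectClosure k p)) :
    letI : Algebra k (PerfectClosure k p) := (PerfectClosure.of k p).toAlgebra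
    IsFinite (Spec.map (CommRingCat.ofHom (algebraMap k (FieldExt.fld k (PerfectClosure k p) t)))) := by
  letI : Algebra k (PerfectClosure k p) := (PerfectClosure.of k p).toAlgebra
  haveI := isAlgebraic_perfectClosure p k
  rw [IsFinite.SpecMap_iff]
  exact RingHom.Finite.of_comp_finite (f := RingHom.id k) (RingHom.finite_algebraMap.mpr inferInstance)

end Stage


-- as in Mathlib's pullback API for schemes
set_option backward.isDefEq.respectTransparency false in
/-- **A purely inseparable regular alteration descends from the perfect closure** (see the module
docstring): if `X^∞ = (Spec K ×_k X)_red`, `K = k^{p^{-∞}}`, has a proper surjective `π : R → X^∞`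
with `R` integral regular and `π` finite radicial over a dense open, then the integral separated
finite-type `k`-scheme `X` has a purely inseparable alteration with regular source. [folklore] -/
theorem exists_isPurelyInseparableAlteration_of_perfectClosure (p : ℕ) [Fact p.Prime]
    {k : Type} [Field k] [CharP k p] {X : Scheme.{0}} (f : X ⟶ Spec (.of k)) [IsSeparated f]
    [LocallyOfFiniteType f] [QuasiCompact f] [IsIntegral X]
    (hinf : ∃ (R : Scheme.{0}) (π : R ⟶ (vanishingIdeal (⊤ : Closeds
        ↑(pullback (Spec.map (CommRingCat.ofHom (PerfectClosure.of k p))) f))).subscheme),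
      IsProper π ∧ IsIntegral R ∧ Scheme.IsRegular R ∧ Function.Surjective π.base ∧
      ∃ U : Scheme.Opens _, Dense (U : Set ↥((vanishingIdeal (⊤ : Closeds
        ↑(pullback (Spec.map (CommRingCat.ofHom (PerfectClosure.of k p))) f))).subscheme)) ∧
        IsFinite (π ∣_ U) ∧ UniversallyInjective (π ∣_ U)) :
    ∃ (Y : Scheme.{0}) (φ : Y ⟶ X), IsPurelyInseparableAlteration φ ∧ Scheme.IsRegular Y := by
  obtain ⟨R, π₀, hπP, hRint, hRreg, hπsurj, U, hU, -, hUui⟩ := hinf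
  haveI := hπP
  haveI := hRint
  haveI := irreducibleSpace_pullback_perfectClosure p f
  haveI hXinf : IsIntegral (vanishingIdeal (⊤ : Closeds
      ↑(pullback (Spec.map (CommRingCat.ofHom (PerfectClosure.of k p))) f))).subscheme :=
    isIntegral_subscheme_vanishingIdeal_top
  -- ### embedding and descent to a finitely generated stage
  obtain ⟨Q, prX, m₀, hQqc, hQsep, hQlft, hm, hprX, hm1, hm2⟩ := exists_closedImmersion_baseChange p f
    (π₀ ≫ (vanishingIdeal (⊤ : Closeds
      ↑(pullback (Spec.map (CommRingCat.ofHom (PerfectClosure.of k p))) f))).subschemeι)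
  haveI := hQqc; haveI := hQsep; haveI := hQlft; haveI := hm
  letI : Algebra k (PerfectClosure k p) := (PerfectClosure.of k p).toAlgebra
  haveI := isAlgebraic_perfectClosure p k
  obtain ⟨t, Rt, ιRt₀, e, hιRt, SqRm₀, he₀⟩ := exists_stage_model_of_closedImmersion Q m₀
  haveI := hιRt
  -- ### notation: aliases with explicit types (all definitional)
  let σK : CommRingCat.of k ⟶ CommRingCat.of (PerfectClosure k p) :=
    CommRingCat.ofHom (PerfectClosure.of k p)
  let XK := pullback (Spec.map σK) f
  let Xinf := (vanishingIdeal (⊤ : Closeds ↑XK)).subscheme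
  let ι₀ : Xinf ⟶ XK := (vanishingIdeal (⊤ : Closeds ↑XK)).subschemeι
  let π : R ⟶ Xinf := π₀
  haveI : IsProper π := hπP
  haveI : Surjective π := ⟨hπsurj⟩
  let ρ : R ⟶ XK := π ≫ ι₀
  haveI : IsProper ρ := inferInstanceAs (IsProper (π ≫ ι₀))
  let kt := FieldExt.fld k (PerfectClosure k p) t
  letI : Field kt := (FieldExt.isField_fld k (PerfectClosure k p) t).toField
  let ιn : k →+* kt := algebraMap k kt
  let ιL : kt →+* PerfectClosure k p := kt.val.toRingHom
  haveI : CharP kt p := (RingHom.charP_iff_charP ιL p).mpr inferInstance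
  have hιLιn : σK = CommRingCat.ofHom ιn ≫ CommRingCat.ofHom ιL := by ext y; rfl
  let Xn := pullback (Spec.map (CommRingCat.ofHom ιn)) f
  let Qn := pullback (Spec.map (CommRingCat.ofHom ιn)) Q.hom
  let m : R ⟶ pullback (Spec.map σK) Q.hom := m₀
  haveI : IsClosedImmersion m := hm
  let ιRn : Rt ⟶ Qn := ιRt₀
  haveI : IsClosedImmersion ιRn := hιRt
  have SqRm : IsPullback (m ≫ pullback.fst _ _) e (Spec.map (CommRingCat.ofHom ιL))
      (ιRn ≫ pullback.fst _ _) := SqRm₀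
  have he : e ≫ ιRn ≫ pullback.snd _ _ = m ≫ pullback.snd _ _ := he₀
  have hm1' : m ≫ pullback.fst _ _ = ρ ≫ pullback.fst _ _ := hm1
  have hm2' : m ≫ pullback.snd _ _ ≫ prX = ρ ≫ pullback.snd _ _ := hm2
  -- ### the stage objects
  let qX : Qn ⟶ Xn := pullback.map _ _ _ _ (𝟙 _) prX (𝟙 _) (by simp) (by rw [Category.comp_id, hprX])
  let ρn : Rt ⟶ Xn := ιRn ≫ qX
  have hρnfst : ρn ≫ pullback.fst _ _ = ιRn ≫ pullback.fst _ _ := by simp [ρn, qX]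
  have hρnsnd : ρn ≫ pullback.snd _ _ = ιRn ≫ pullback.snd _ _ ≫ prX := by simp [ρn, qX]
  -- `XK'' = Spec K ×_{k(t)} Xn ≅ XK`
  let XK'' := pullback (Spec.map (CommRingCat.ofHom ιL)) (pullback.fst (Spec.map (CommRingCat.ofHom ιn)) f)
  let snd'' : XK'' ⟶ Xn := pullback.snd _ _
  haveI hflatL : Flat (Spec.map (CommRingCat.ofHom ιL)) := flat_specMap_of_field ιL
  haveI hsurjL : Surjective (Spec.map (CommRingCat.ofHom ιL)) := surjective_specMap_field ιL
  have hradL : ∀ x : PerfectClosure k p, ∃ (n : ℕ) (y : kt), ιL y = x ^ p ^ n := fun x => by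
    obtain ⟨n', y, hy⟩ := perfectClosure_pow_mem p x
    exact ⟨n', ιn y, hy⟩
  haveI huiL : UniversallyInjective (Spec.map (CommRingCat.ofHom ιL)) :=
    universallyInjective_specMap_field_of_pow_mem ιL p hradL
  haveI hintL : IsIntegralHom (Spec.map (CommRingCat.ofHom ιL)) :=
    isIntegralHom_specMap_of_pow_mem ιL p hradL
  haveI : Flat snd'' := MorphismProperty.pullback_snd _ _ hflatL
  haveI : Surjective snd'' := MorphismProperty.pullback_snd _ _ hsurjL
  haveI : UniversallyInjective snd'' := universallyInjective_pullback_snd _ _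
  haveI : UniversallyClosed snd'' := MorphismProperty.pullback_snd _ _ inferInstance
  haveI : QuasiCompact snd'' := inferInstance
  have hcondXK : pullback.snd (Spec.map σK) f ≫ f = pullback.fst _ _ ≫ Spec.map σK :=
    pullback.condition.symm
  have hcondXn : pullback.snd (Spec.map (CommRingCat.ofHom ιn)) f ≫ f =
      pullback.fst _ _ ≫ Spec.map (CommRingCat.ofHom ιn) := pullback.condition.symm
  have hcond'' : snd'' ≫ pullback.fst _ _ = pullback.fst _ _ ≫ Spec.map (CommRingCat.ofHom ιL) :=
    pullback.condition.symm
  let eXK : XK'' ⟶ XK := pullback.lift (pullback.fst _ _) (snd'' ≫ pullback.snd _ _) (by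
    rw [Category.assoc, hcondXn, ← Category.assoc, hcond'', Category.assoc, ← Spec.map_comp, ← hιLιn])
  let dXn : XK ⟶ Xn := pullback.lift (pullback.fst _ _ ≫ Spec.map (CommRingCat.ofHom ιL))
    (pullback.snd _ _) (by rw [Category.assoc, ← Spec.map_comp, ← hιLιn, hcondXK])
  let dXK : XK ⟶ XK'' := pullback.lift (pullback.fst _ _) dXn (by simp [dXn])
  have hed : eXK ≫ dXK = 𝟙 _ := by
    apply pullback.hom_ext
    · simp [eXK, dXK]
    · apply pullback.hom_ext
      · simpa [eXK, dXK, dXn] using hcond''.symm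
      · simp [eXK, dXK, dXn, snd'']
  have hde : dXK ≫ eXK = 𝟙 _ := by
    apply pullback.hom_ext
    · simp [eXK, dXK]
    · simp [eXK, dXK, dXn, snd'']
  haveI : IsIso eXK := ⟨dXK, hed, hde⟩
  haveI : IsIso dXK := ⟨eXK, hde, hed⟩
  -- ### `ρK : R → XK''` and the key cartesian square `R = XK'' ×_{Xn} Rt`
  let gR := m ≫ pullback.fst (Spec.map σK) Q.hom
  let ρK : R ⟶ XK'' := pullback.lift gR (e ≫ ρn)
    (by rw [Category.assoc e ρn, hρnfst]; exact SqRm.w)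
  have SqX : IsPullback e ρK ρn snd'' := by
    refine IsPullback.of_bot (v₂₁ := pullback.fst _ _) (v₂₂ := pullback.fst _ _)
      (h₃₁ := Spec.map (CommRingCat.ofHom ιL)) ?_ (pullback.lift_snd _ _ _).symm
      (IsPullback.of_hasPullback _ _).flip
    rw [pullback.lift_fst, hρnfst]
    exact SqRm.flip
  have hρKe : ρK ≫ eXK = ρ := by
    apply pullback.hom_ext
    · simp only [ρK, eXK, gR, Category.assoc, pullback.lift_fst]
      rw [hm1']
    · simp only [ρK, eXK, snd'', Category.assoc, pullback.lift_snd, pullback.lift_snd_assoc]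
      rw [hρnsnd, reassoc_of% he, hm2']
  have hρK : ρK = ρ ≫ dXK := by
    rw [← hρKe, Category.assoc, hed, Category.comp_id]
  haveI : UniversallyClosed ρK := by rw [hρK]; infer_instance
  haveI : QuasiCompact ρK := by rw [hρK]; infer_instance
  -- ### properties of `R_t` and `ρ_t`
  haveI : Flat e := MorphismProperty.of_isPullback (P := @Flat) SqRm hflatL
  haveI : Surjective e := MorphismProperty.of_isPullback (P := @Surjective) SqRm hsurjL
  haveI : IsLocallyNoetherian Rt :=
    LocallyOfFiniteType.isLocallyNoetherian (ιRn ≫ pullback.fst (Spec.map (CommRingCat.ofHom ιn)) Q.hom)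
  have hRnreg : Scheme.IsRegular Rt := isRegular_of_flat_surjective e hRreg
  haveI hRnint : IsIntegral Rt := isIntegral_of_flat_surjective e
  have hQ : (@Surjective ⊓ @Flat ⊓ @QuasiCompact : MorphismProperty Scheme) snd'' :=
    ⟨⟨inferInstance, inferInstance⟩, inferInstance⟩
  haveI : UniversallyClosed ρn :=
    MorphismProperty.of_isPullback_of_descendsAlong (P := @UniversallyClosed) SqX.flip hQ inferInstance
  haveI : IsSeparated (qX ≫ pullback.fst _ _) := by
    have : qX ≫ pullback.fst _ _ = pullback.fst _ _ := by simp [qX]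
    rw [this]; infer_instance
  haveI : IsSeparated qX := IsSeparated.of_comp qX (pullback.fst _ _)
  haveI : IsSeparated ρn := inferInstanceAs (IsSeparated (ιRn ≫ qX))
  haveI : LocallyOfFiniteType (ρn ≫ pullback.fst _ _) := by rw [hρnfst]; infer_instance
  haveI : LocallyOfFiniteType ρn := locallyOfFiniteType_of_comp ρn (pullback.fst _ _)
  haveI hρnP : IsProper ρn := ⟨⟩
  haveI hρnsurj : Surjective ρn := by
    haveI : Surjective ρ := inferInstanceAs (Surjective (π ≫ ι₀))
    haveI : Surjective (ρK ≫ snd'') := by rw [hρK]; infer_instance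
    haveI : Surjective (e ≫ ρn) := by rw [SqX.w]; infer_instance
    exact Surjective.of_comp e ρn
  -- ### the good open, transported to `X_t`
  -- the square with corner `ρ : R → XK`
  have SqX' : IsPullback ρ e (dXK ≫ snd'') ρn := by
    refine IsPullback.of_iso SqX.flip (Iso.refl _) (asIso eXK) (Iso.refl _) (Iso.refl _) ?_ ?_ ?_ ?_
    · rw [Iso.refl_hom, Category.id_comp, asIso_hom, hρKe]
    · simp
    · rw [Iso.refl_hom, Category.comp_id, asIso_hom, ← Category.assoc, hed, Category.id_comp]
    · simp
  -- `φ = ι₀ ≫ dXK ≫ snd'' : X^∞ → X_t` is a homeomorphism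
  let φ : Xinf ⟶ Xn := ι₀ ≫ dXK ≫ snd''
  have hφ : IsHomeomorph φ.base := by
    have h1 : IsHomeomorph snd''.base :=
      isHomeomorph_of_universallyClosed_of_universallyInjective snd''
    have h2 : IsHomeomorph dXK.base := (Scheme.homeoOfIso (asIso dXK)).isHomeomorph
    have h3 : IsHomeomorph ι₀.base :=
      isHomeomorph_iff_continuous_isClosedMap_bijective.mpr
        ⟨ι₀.continuous, ι₀.isClosedMap, ι₀.isClosedEmbedding.injective, ι₀.surjective⟩
    change IsHomeomorph (ι₀ ≫ dXK ≫ snd'').base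
    rw [Scheme.Hom.comp_base, Scheme.Hom.comp_base]
    exact (h1.comp h2).comp h3
  let Un : Xn.Opens := ⟨φ.base '' (U : Set Xinf), hφ.isOpenMap _ U.2⟩
  have hUeq : ι₀ ⁻¹ᵁ ((dXK ≫ snd'') ⁻¹ᵁ Un) = U := by
    ext1
    change φ.base ⁻¹' (φ.base '' (U : Set Xinf)) = (U : Set Xinf)
    exact Set.preimage_image_eq _ hφ.injective
  -- restriction of the square over `Un` and descent of universal injectivity
  obtain ⟨eW, -, SqW⟩ := IsPullback.exists_restrict SqX' Un
  haveI : UniversallyInjective (π ∣_ U) := hUui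
  have hρui : UniversallyInjective (ρ ∣_ ((dXK ≫ snd'') ⁻¹ᵁ Un)) := by
    change UniversallyInjective ((π ≫ ι₀) ∣_ ((dXK ≫ snd'') ⁻¹ᵁ Un))
    rw [morphismRestrict_comp]
    have h1 := universallyInjective_morphismRestrict_of_le π hUeq.le
    have h2 : UniversallyInjective (ι₀ ∣_ ((dXK ≫ snd'') ⁻¹ᵁ Un)) :=
      MorphismProperty.of_isPullback (isPullback_morphismRestrict ι₀ _).flip
        (inferInstance : UniversallyInjective ι₀)
    exact MorphismProperty.comp_mem _ _ _ h1 h2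
  have hQ' : (@Surjective ⊓ @Flat ⊓ @QuasiCompact : MorphismProperty Scheme) ((dXK ≫ snd'') ∣_ Un) :=
    ⟨⟨IsZariskiLocalAtTarget.restrict (inferInstance : Surjective (dXK ≫ snd'')) Un,
      IsZariskiLocalAtTarget.restrict (inferInstance : Flat (dXK ≫ snd'')) Un⟩, inferInstance⟩
  haveI hρnui : UniversallyInjective (ρn ∣_ Un) :=
    MorphismProperty.of_isPullback_of_descendsAlong (P := @UniversallyInjective) SqW hQ' hρui
  -- finiteness over `Un`: proper and radicial
  haveI : LocallyQuasiFinite (ρn ∣_ Un) := LocallyQuasiFinite.of_injective (ρn ∣_ Un).injective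
  haveI hρnfin : IsFinite (ρn ∣_ Un) := IsFinite.of_isProper_of_locallyQuasiFinite _
  -- ### the projection `X_t → X` and the composite alteration
  let pr : Xn ⟶ X := pullback.snd (Spec.map (CommRingCat.ofHom ιn)) f
  haveI : IsFinite (Spec.map (CommRingCat.ofHom ιn)) := isFinite_specMap_stage p k t
  haveI : UniversallyInjective (Spec.map (CommRingCat.ofHom ιn)) :=
    universallyInjective_specMap_field_of_pow_mem ιn p (stage_pow_mem p k t)
  haveI : Surjective (Spec.map (CommRingCat.ofHom ιn)) := surjective_specMap_field ιn
  haveI : IsFinite pr := MorphismProperty.pullback_snd _ _ inferInstance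
  haveI : UniversallyInjective pr := universallyInjective_pullback_snd _ _
  haveI : Surjective pr := MorphismProperty.pullback_snd _ _ inferInstance
  -- the open `V = X ∖ pr (X_t ∖ Un)` of `X`, with `pr⁻¹ V ≤ Un`
  have hC : IsClosed (pr.base '' (Un : Set Xn)ᶜ) := pr.isClosedMap _ Un.isOpen.isClosed_compl
  let V : X.Opens := ⟨(pr.base '' (Un : Set Xn)ᶜ)ᶜ, hC.isOpen_compl⟩
  have hVU : pr ⁻¹ᵁ V ≤ Un := by
    intro x hx
    by_contra hxU
    exact hx ⟨x, hxU, rfl⟩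
  have hVne : (V : Set X).Nonempty := by
    obtain ⟨u₀, hu₀⟩ := hU.nonempty
    refine ⟨pr.base (φ.base u₀), ?_⟩
    rintro ⟨x, hxU, hx⟩
    apply hxU
    rw [pr.injective hx]
    exact ⟨u₀, hu₀, rfl⟩
  refine ⟨Rt, ρn ≫ pr, ⟨inferInstance, inferInstance, inferInstance, V, hVne, ?_, ?_⟩, hRnreg⟩
  · rw [morphismRestrict_comp]
    exact MorphismProperty.comp_mem _ _ _ (isFinite_morphismRestrict_of_le ρn hVU)
      (inferInstance : IsFinite (pr ∣_ V))
  · rw [morphismRestrict_comp]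
    exact MorphismProperty.comp_mem _ _ _ (universallyInjective_morphismRestrict_of_le ρn hVU)
      (MorphismProperty.of_isPullback (isPullback_morphismRestrict pr V).flip
        (inferInstance : UniversallyInjective pr))

namespace PalterationThesis.PerfectTransfer

/-- **Stub `stub_pialtOfPerfect` of line `Sketch`**: PIAlt over the perfect closure `k^{p^{-∞}}`
implies PIAlt over `k` — apply the hypothesis to `X^∞ = (Spec K ×_k X)_red`, an integral
separated `K`-scheme of finite type, and descend. [folklore] -/
theorem stub_pialtOfPerfect (p : ℕ) [Fact p.Prime] (k : Type) [Field k] [CharP k p]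
    (hPIK : ∀ (X : Scheme.{0}) (f : X ⟶ Spec (.of (PerfectClosure k p))),
      IsSeparated f → LocallyOfFiniteType f → QuasiCompact f → IsIntegral X →
      ∃ (X' : Scheme.{0}) (g : X' ⟶ X), IsProper g ∧ IsIntegral X' ∧ Scheme.IsRegular X' ∧
        Function.Surjective g.base ∧ ∃ U : X.Opens, Dense (U : Set X) ∧ IsFinite (g ∣_ U) ∧
        UniversallyInjective (g ∣_ U))
    (X : Scheme.{0}) (f : X ⟶ Spec (.of k)) [IsSeparated f] [LocallyOfFiniteType f]
    [QuasiCompact f] [IsIntegral X] :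
    ∃ (X' : Scheme.{0}) (g : X' ⟶ X), IsProper g ∧ IsIntegral X' ∧ Scheme.IsRegular X' ∧
      Function.Surjective g.base ∧ ∃ U : X.Opens, Dense (U : Set X) ∧ IsFinite (g ∣_ U) ∧
      UniversallyInjective (g ∣_ U) := by
  haveI := irreducibleSpace_pullback_perfectClosure p f
  haveI hint : IsIntegral (vanishingIdeal (⊤ : Closeds
      ↑(pullback (Spec.map (CommRingCat.ofHom (PerfectClosure.of k p))) f))).subscheme :=
    isIntegral_subscheme_vanishingIdeal_top
  exact pialtConclusion_of_exists_isPurelyInseparableAlteration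
    (exists_isPurelyInseparableAlteration_of_perfectClosure p f (hPIK _ ((vanishingIdeal (⊤ : Closeds
      ↑(pullback (Spec.map (CommRingCat.ofHom (PerfectClosure.of k p))) f))).subschemeι ≫
        pullback.fst _ f) inferInstance inferInstance inferInstance hint))

end PalterationThesis.PerfectTransfer

end Summit.ResolutionOfSingularities.ResolutionOfSingularities.Theorems

end
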